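import Summits.Ventures.LatticeQCDFlow.Exactness.IMHCoupledEstimatorBernsteinUnboundedWeights
import HarnessLib

/-!
# The every-weight Bernstein bar of the coupled flow-MCMC estimator, valid UNIFORMLY over the burn-in `k ≤ k_max`: the discarded
# length may be chosen after the run (e.g. from the observed meeting times) at the price of a union bound

HONEST FRAMING: exact (Metropolis-corrected) sampling algorithms for lattice gauge theory;
figures of merit are autocorrelation/cost numbers at stated couplings and volumes; no
continuum-physics claim.

Venture `LatticeQCDFlow` (cell pub-lqcd), topic `Exactness`; FANOUT row 30 (lean-1, GEN-41).  NEW WORK of the cell, sequel of GEN-40's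
`IMHCoupledEstimatorBernsteinUnboundedWeights` (setting there: standard Borel `Ω`, every proposal law `q`, every positive normalised weight
`w`, CRN pair kernel `K̂`, mutually independent pair streams `Z_j` from the practical start `ν̂_x` with `w(x) ≤ M`, the coupled estimator
`H_{k,N}`, `a ≤ f ≤ c`, `c₁ = E_q[min(1, w)]`, `ρ = 1 − c₁/max(1, M)`).  GEN-40's bar holds for a burn-in `k` FIXED IN ADVANCE; in practice `k`
is read off the run (a multiple of the largest observed meeting time), and the same pair streams yield `H_{k,N}` for every `k`.  Companion
of GEN-41's `IMHReplicaReadoutAnytimeCertificate` (uniformity in the number of replicas).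

* `setOf_exists_le_eq_biUnion` [bookkeeping]; **`crnLag_replicas_burnIn_bernstein_abs_target_uniformBurnIn`** — for radii `ε_k ≥ 0`, a
  variance bound `σ² ≥ Var_{δ_xK^k} f` for every `k ≤ k_max` (e.g. `(c − a)²/4`), `R ≥ 1`:
  `P(∃ k ≤ k_max, |H̄_R^{(k)} − π f| ≥ ε_k + (c − a)(π{M < w} + ρ^k)) ≤ Σ_{k ≤ k_max} [2·exp(−Rε_k²/(2(σ² + (c − a)ε_k/3))) + R·(q{M < w} + ρ^k)]`
  — so a burn-in chosen from the data among `0, …, k_max` keeps a certificate, the coupling terms adding up to at most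
  `R·((k_max + 1)·q{M < w} + Σ_k ρ^k) ≤ R·((k_max + 1)·q{M < w} + max(1, M)/c₁)`.
NOT CLAIMED: the closed form of the geometric sum (left as a finite sum); joint uniformity in `k` and `R` (combine with the anytime file by one
more union bound).  No `sorry`, no new definitions, nothing cited as a fact.
-/

noncomputable section

namespace Summit.Ventures.LatticeQCDFlow.Exactness

open MeasureTheory ProbabilityTheory Function Finset Filter
open scoped _root_.ENNReal unitInterval Topology
open Summit.Ventures.LatticeQCDFlow.Scoring

variable {Ω : Type*} [MeasurableSpace Ω] {q : Measure Ω} [IsProbabilityMeasure q] {w : Ω → ℝ}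

section Replicas

variable {Ω' : Type*} {mΩ' : MeasurableSpace Ω'} {μ : Measure Ω'} [IsProbabilityMeasure μ]
  {Z : ℕ → Ω' → (ℕ → Ω × Ω)}

omit mΩ' in
/-- `{ω | ∃ k ≤ k_max, P k ω} = ⋃_{k ∈ range(k_max + 1)} {ω | P k ω}`. [ours, bookkeeping] -/
theorem setOf_exists_le_eq_biUnion (P : ℕ → Ω' → Prop) (kmax : ℕ) :
    {ω | ∃ k, k ≤ kmax ∧ P k ω} = ⋃ k ∈ range (kmax + 1), {ω | P k ω} := by
  ext ω
  simp only [Set.mem_setOf_eq, Set.mem_iUnion, mem_range, Nat.lt_succ_iff, exists_prop]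

/-- **THE EVERY-WEIGHT BERNSTEIN BAR, UNIFORMLY OVER THE BURN-IN `k ≤ k_max`** (practical start at `x` with `w(x) ≤ M`, leading run one
update ahead; `R ≥ 1` independent coupled pairs, window `N`; radii `ε_k ≥ 0`; `σ² > 0` with `Var_{δ_xK^k} f ≤ σ²` for `k ≤ k_max`):
`P(∃ k ≤ k_max, |H̄_R^{(k)} − π f| ≥ ε_k + (c − a)(π{M < w} + ρ^k)) ≤ Σ_{k ≤ k_max} [2·exp(−Rε_k²/(2(σ² + (c − a)ε_k/3))) + R·(q{M < w} + ρ^k)]`. [ours] -/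
theorem crnLag_replicas_burnIn_bernstein_abs_target_uniformBurnIn [StandardBorelSpace Ω] [Nonempty Ω] [MeasurableSingletonClass Ω]
    [MeasurableEq Ω] [Fact (Measurable w)] (hw0 : ∀ y, 0 < w y) [IsProbabilityMeasure (q.withDensity fun y => ENNReal.ofReal (w y))]
    (Khat : Kernel (Ω × Ω) (Ω × Ω)) [IsMarkovKernel Khat]
    (hK : ∀ z : Ω × Ω, Khat z = (q.prod (volume : Measure unitInterval)).map (fun p : Ω × unitInterval =>
      ((if (p.2 : ℝ) * w z.1 ≤ w p.1 then p.1 else z.1), (if (p.2 : ℝ) * w z.2 ≤ w p.1 then p.1 else z.2))))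
    (x : Ω) {M : ℝ} (hxM : w x ≤ M) (ν : Measure (Ω × Ω)) [IsProbabilityMeasure ν]
    (hν : ν = (indepMH q w x).map fun y : Ω => (y, x)) {f : Ω → ℝ} (hf : Measurable f) {a c : ℝ} (ha : ∀ y, a ≤ f y)
    (hc : ∀ y, f y ≤ c) (N kmax : ℕ) (hZm : ∀ j, Measurable (Z j))
    (hlaw : ∀ j, μ.map (Z j) = Kernel.trajMeasure (X := fun _ : ℕ => Ω × Ω) ν
      (fun n : ℕ => Khat.comap (fun h : (i : ↥(Finset.Iic n)) → Ω × Ω => h ⟨n, Finset.mem_Iic.2 le_rfl⟩)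
        (measurable_pi_apply _)))
    (hind : iIndepFun Z μ) {σ2 : ℝ} (hσ : 0 < σ2)
    (hσk : ∀ k, k ≤ kmax → variance f ((fun m : Measure Ω => m.bind (indepMH q w))^[k] (Measure.dirac x)) ≤ σ2)
    {ε : ℕ → ℝ} (hε : ∀ k, 0 ≤ ε k) {R : ℕ} (hR : 1 ≤ R) :
    μ.real {ω | ∃ k, k ≤ kmax ∧ ε k + (c - a) * ((q.withDensity fun y => ENNReal.ofReal (w y)) {y | M < w y} +
          (1 - (∫⁻ y, ENNReal.ofReal (min 1 (w y)) ∂q) / ENNReal.ofReal (max 1 M)) ^ k).toReal ≤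
        |(R : ℝ)⁻¹ * ∑ j ∈ range R, (f ((Z j ω k).2) + ∑ n ∈ range N, (f ((Z j ω (k + n)).1) - f ((Z j ω (k + n)).2))) -
          ∫ y, f y ∂(q.withDensity fun y => ENNReal.ofReal (w y))|} ≤
      ∑ k ∈ range (kmax + 1), (2 * Real.exp (-(R * ε k ^ 2) / (2 * (σ2 + (c - a) * ε k / 3))) +
        R * (q {y | M < w y} + (1 - (∫⁻ y, ENNReal.ofReal (min 1 (w y)) ∂q) / ENNReal.ofReal (max 1 M)) ^ k).toReal) := by
  rw [setOf_exists_le_eq_biUnion]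
  refine (measureReal_biUnion_finset_le _ _).trans (sum_le_sum fun k hk => ?_)
  exact crnLag_replicas_burnIn_bernstein_abs_target_everyWeight hw0 Khat hK x hxM ν hν hf ha hc k N hZm hlaw hind hσ
    (hσk k (Nat.lt_succ_iff.1 (mem_range.1 hk))) (hε k) hR

/-- **THE COUPLING TERMS ADD UP TO AT MOST `R·((k_max + 1)·q{M < w} + Σ_{k ≤ k_max} ρ^k)`** and the geometric sum is at most
`max(1, M)/c₁` when `c₁ > 0` (real form of `Σ_k ρ^k ≤ 1/(1 − ρ)`): the bookkeeping behind the docstring's reading. [ours, bookkeeping] -/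
theorem sum_geometric_le_inv_one_sub {ρ : ℝ} (hρ0 : 0 ≤ ρ) (hρ1 : ρ < 1) (K : ℕ) :
    ∑ k ∈ range K, ρ ^ k ≤ (1 - ρ)⁻¹ :=
  calc ∑ k ∈ range K, ρ ^ k ≤ ∑' k, ρ ^ k :=
        (summable_geometric_of_lt_one hρ0 hρ1).sum_le_tsum (range K) (fun k _ => pow_nonneg hρ0 k)
    _ = (1 - ρ)⁻¹ := tsum_geometric_of_lt_one hρ0 hρ1

end Replicas

end Summit.Ventures.LatticeQCDFlow.Exactness
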